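import Literature.Geometry.Kaehler.KaehlerOsculatingExchangeProofs
import Literature.Geometry.Kaehler.KaehlerOsculatingExpansionProofs
import Literature.NumberTheory.Transcendental.KaehlerIdentityCinftyLinearProofs

/-!
# The Kähler identity `[∂̄*, L] = i∂` (in the `alternatizeUncurryFin` normalisation): assembly

We assemble Voisin's proof (Voisin (2002), §6.1.1, Prop. 6.5 with Lemma 6.6, via the osculation
Prop. 3.14) of the first-order Kähler identity, for the Lefschetz operator `L` written as the
canonical alternatization `Lform[G]` of `v ↦ ½⟪Jv, ·⟫ ∧ ·` (`KaehlerLefschetzOperatorProofs.lean`)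
and `∂̄* = -⋆∂⋆`:

  `P α := ∂̄*(L α) - L(∂̄* α) - i ∂α = 0`  for every smooth form `α` of positive degree
  (`kaehlerP_apply_eq_zero`), and `∂̄*(L α) - i∂α = 0` on functions (`…_zero`),

on a Kähler manifold: a complex manifold (`IsManifold 𝓘(ℂ, E) ω M`) with a smooth Hermitian metric
(`hH`) whose Kähler form is closed (`hK`), an orientation with smooth volume form (`ho`).

The proof, pointwise at `x₀`: `P` is `C^∞`-linear (`kaehlerP_fun_smul`) and local; by the Kähler
condition the first jet `D` of the coordinate metric at `x₀` satisfies the relation of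
`chartMetric_kaehler_jet`, so the Koszul map `B` is `ℂ`-bilinear (`koszul_J'`) and the osculating
unitary frame `M_f = √Q ∘ (1 + B(· - c))` (`OsculatingUnitaryFrame(Sqrt)Proofs.lean`) is a
`ℂ`-linear isometry to first order with `DM_f(c) = B` symmetric; the attached test forms `Θ_{f,η}`
satisfy `P Θ = 0` at `x₀` (`kaehlerP_testForm_apply_eq_zero`: `L`, `⋆` act on them through the
constant model operators and `dΘ(x₀) = 0`), and every smooth `α` is `∑ ρᵢ Θᵢ` near `x₀`
(`exists_expansion_testForms`), whence `P α (x₀) = ∑ ρᵢ(x₀) P Θᵢ (x₀) = 0`.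

## References

* C. Voisin, *Hodge Theory and Complex Algebraic Geometry I* (2002), Prop. 3.14; §6.1.1,
  Prop. 6.5, Lemma 6.6. [Voisin2002]
* D. Huybrechts, *Complex Geometry* (2005), Prop. 1.2.26, Prop. 3.1.12. [Huybrechts2005]
-/

noncomputable section

open scoped Manifold ContDiff Topology RealInnerProductSpace
open Set Function Bundle Module Filter ContinuousAlternatingMap Complex
open Literature.Analysis.OperatorTheory Literature.Analysis.Complex Literature.Geometry.Kaehler

namespace Literature.NumberTheory.Transcendental

set_option quotPrecheck false

section Assembly

variable {E : Type*} [NormedAddCommGroup E] [NormedSpace ℂ E] [FiniteDimensional ℂ E]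
  {M : Type*} [TopologicalSpace M] [ChartedSpace E M] [IsManifold 𝓘(ℝ, E) ∞ M]
  [IsManifold 𝓘(ℂ, E) ω M] [T2Space M] {n : ℕ} [Fact (finrank ℝ E = n)]
  [RiemannianBundle (fun x : M ↦ TangentSpace 𝓘(ℝ, E) x)]
  [IsContMDiffRiemannianBundle 𝓘(ℝ, E) ∞ E (fun x : M ↦ TangentSpace 𝓘(ℝ, E) x)]
  (o : (x : M) → Orientation ℝ (TangentSpace 𝓘(ℝ, E) x) (Fin n))

set_option hygiene false in
/-- The covector family of the model Lefschetz operator. -/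
local notation "θE[" B' "]" => (2⁻¹ : ℝ) • ContinuousLinearMap.comp B'
  ((Complex.I • ContinuousLinearMap.id ℂ E).restrictScalars ℝ)

set_option hygiene false in
/-- The canonical family of the model Lefschetz operator. -/
local notation "LfamE[" B' "]" η:max =>
  ContinuousLinearMap.comp (ContinuousAlternatingMap.alternatizeUncurryFinCLM ℝ E ℂ)
    (ContinuousLinearMap.comp (ContinuousLinearMap.flip
      (ContinuousLinearMap.smulRightL ℝ E (E [⋀^Fin _]→L[ℝ] ℂ)) η) (θE[B']))

set_option hygiene false in
/-- The model Lefschetz operator. -/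
local notation "LopE[" B' "]" η:max =>
  ContinuousAlternatingMap.alternatizeUncurryFin (𝕜 := ℝ) (E := E) (F := ℂ) (LfamE[B'] η)

set_option hygiene false in
/-- The Lefschetz operator on forms on `M`. -/
local notation "Lform[" G' "]" β:max =>
  @id (MForm 𝓘(ℝ, E) M ℂ (_ + 1 + 1)) (fun x ↦ (LopE[G' x] (β x) :))

set_option hygiene false in
/-- Voisin's operator `P = [∂̄*, L] - i∂` in positive degree. -/
local notation "KP[" G ", " o ", " h₁ ", " h₃ "]" β:max =>
  (dolbeaultBarAdjoint o h₁ (Lform[G] β) - Lform[G] (dolbeaultBarAdjoint o h₃ β) -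
    Complex.I • dolbeault β)

set_option hygiene false in
/-- The same operator on `0`-forms. -/
local notation "KP₀[" G ", " o ", " h₁ "]" β:max =>
  (dolbeaultBarAdjoint o h₁ (Lform[G] β) - Complex.I • dolbeault β)

set_option hygiene false in
/-- The coordinate expression of the metric `G` in the chart at `x₀`, as a function on `E`. -/
local notation "ĜF[" G ", " x₀ "]" => (fun y : E ↦ ContinuousLinearMap.bilinearComp
  (G ((extChartAt 𝓘(ℝ, E) x₀).symm y))
  (tangentCoordChange 𝓘(ℝ, E) x₀ ((extChartAt 𝓘(ℝ, E) x₀).symm y) ((extChartAt 𝓘(ℝ, E) x₀).symm y))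
  (tangentCoordChange 𝓘(ℝ, E) x₀ ((extChartAt 𝓘(ℝ, E) x₀).symm y) ((extChartAt 𝓘(ℝ, E) x₀).symm y)))

omit [FiniteDimensional ℂ E] [IsManifold 𝓘(ℝ, E) ∞ M] [IsManifold 𝓘(ℂ, E) ω M] [T2Space M]
  [Fact (finrank ℝ E = n)] [RiemannianBundle fun x : M ↦ TangentSpace 𝓘(ℝ, E) x]
  [IsContMDiffRiemannianBundle 𝓘(ℝ, E) ∞ E fun x : M ↦ TangentSpace 𝓘(ℝ, E) x] in
set_option synthInstance.maxHeartbeats 400000 in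
/-- Derivative of `y ↦ F y a b` for a differentiable family of bilinear forms. [folklore] -/
theorem hasFDerivAt_apply_apply {F : E → E →L[ℝ] E →L[ℝ] ℝ} {D : E →L[ℝ] E →L[ℝ] E →L[ℝ] ℝ}
    {c : E} (hF : HasFDerivAt F D c) (a b : E) :
    HasFDerivAt (fun y ↦ F y a b) ((D.flip a).flip b) c := by
  have h1 := hF.clm_apply (hasFDerivAt_const a c)
  have h2 := h1.clm_apply (hasFDerivAt_const b c)
  refine h2.congr_fderiv ?_
  ext u
  simp only [ContinuousLinearMap.flip_apply, ContinuousLinearMap.comp_zero, zero_add]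

set_option maxHeartbeats 1600000 in
/-- **The Kähler identity `[∂̄*, L] = i∂`, positive degree** (Voisin (2002), Prop. 6.5 with
Lemma 6.6; Huybrechts (2005), Prop. 3.1.12), for the alternatization-normalised Lefschetz operator
`Lform[G]` of the Hermitian metric `G x v w = ⟪v, w⟫ₓ` and `∂̄* = -⋆∂⋆`: on a complex manifold with
closed Kähler form, `∂̄*(Lα) - L(∂̄*α) - i∂α = 0` for every smooth `(k+1)`-form `α`. Proof by
Voisin's osculation argument, see the module docstring. [cite: Voisin2002, §6.1.1 Prop. 6.5] -/
theorem kaehlerP_apply_eq_zero (ho : IsSmoothForm (riemannianVolumeForm o))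
    (G : M → E →L[ℝ] E →L[ℝ] ℝ) (hG : ∀ (x : M) (v w : TangentSpace 𝓘(ℝ, E) x), G x v w = ⟪v, w⟫)
    (hH : ∀ x v w, G x (Complex.I • v) (Complex.I • w) = G x v w)
    (hK : IsClosedForm (RiemannianBundle.g (E := fun x : M ↦ TangentSpace 𝓘(ℝ, E) x)).kaehlerForm)
    {k m₁ m₃ : ℕ} (h₁ : (k + 1 + 1 + 1) + m₁ = n) (h₃ : (k + 1) + m₃ = n)
    (α : MForm 𝓘(ℝ, E) M ℂ (k + 1)) (hα : IsSmoothForm α) (x₀ : M) :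
    (KP[G, o, h₁, h₃] α) x₀ = 0 := by
  haveI : CompleteSpace E := FiniteDimensional.complete ℂ E
  -- the complex structure on the model space
  set J : E →L[ℝ] E := (Complex.I • ContinuousLinearMap.id ℂ E).restrictScalars ℝ with hJdef
  have hJa : ∀ v, J v = Complex.I • v := fun v ↦ rfl
  have hJJ : ∀ v, J (J v) = -v := fun v ↦ by
    rw [hJa, hJa, smul_smul, Complex.I_mul_I, neg_one_smul]
  -- the metric at `x₀`
  have hpos : ∀ a, a ≠ 0 → 0 < G x₀ a a := chartMetric_pos G hG x₀
  have hGs : ∀ x a b, G x a b = G x b a := fun x a b ↦ by rw [hG, hG, real_inner_comm]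
  have hsymm : ∀ a b, G x₀ a b = G x₀ b a := hGs x₀
  have hJskew : ∀ a b, G x₀ (J a) b = -G x₀ a (J b) := fun a b ↦ by
    have h := hH x₀ a (Complex.I • b)
    rw [smul_smul, Complex.I_mul_I, neg_one_smul, map_neg] at h
    rw [hJa, hJa]
    linarith
  have hHJ : ∀ (x : M) (v w : TangentSpace 𝓘(ℝ, E) x), ⟪tangentJ E x v, tangentJ E x w⟫ = ⟪v, w⟫ :=
    fun x v w ↦ by rw [← hG, ← hG, tangentJ_apply, tangentJ_apply, hH]
  have hG' : ∀ (x : M) (v w : TangentSpace 𝓘(ℝ, E) x), G x v w = inner ℝ v w := hG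
  obtain ⟨S, hS, -⟩ := exists_riesz (G x₀) hpos
  -- the coordinate metric in the chart at `x₀` and its jet
  have hĜc := chartMetric_apply_c G x₀
  have hĜsymm : ∀ y a b, ĜF[G, x₀] y a b =
      ĜF[G, x₀] y b a :=
    fun y a b ↦ chartMetric_symm G hGs x₀ y a b
  have hĜs := eventually_contDiffAt_chartMetric G hG x₀
  have hĜcont := hĜs.self_of_nhds.continuousAt
  have hĜJ : ∀ᶠ y in 𝓝 (extChartAt 𝓘(ℝ, E) x₀ x₀), ∀ a b, ĜF[G, x₀] y (J a) (J b) =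
      ĜF[G, x₀] y a b := by
    filter_upwards [(isOpen_extChartAt_target (I := 𝓘(ℝ, E)) x₀).mem_nhds
      (mem_extChartAt_target x₀)] with y hy a b
    exact chartMetric_hermitian G hH x₀ hy a b
  have hD := (hĜs.self_of_nhds.differentiableAt (by simp)).hasFDerivAt
  set D := fderiv ℝ ĜF[G, x₀] (extChartAt 𝓘(ℝ, E) x₀ x₀) with hDdef
  have hDab : ∀ a b, (D.flip a).flip b = fderiv ℝ (fun y ↦ ĜF[G, x₀] y a b) (extChartAt 𝓘(ℝ, E) x₀ x₀) :=
    fun a b ↦ (hasFDerivAt_apply_apply hD a b).fderiv.symm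
  have hDsymm : ∀ u a b, D u a b = D u b a := fun u a b ↦ by
    have h := congrArg (fun T : E →L[ℝ] ℝ ↦ T u) ((hDab a b).trans
      ((congrArg (fun F : E → ℝ ↦ fderiv ℝ F (extChartAt 𝓘(ℝ, E) x₀ x₀))
        (funext fun y ↦ hĜsymm y a b)).trans (hDab b a).symm))
    simpa only [ContinuousLinearMap.flip_apply] using h
  have hDJ : ∀ u a b, D u (J a) (J b) = D u a b := fun u a b ↦ by
    have hev : (fun y ↦ ĜF[G, x₀] y (J a) (J b)) =ᶠ[𝓝 (extChartAt 𝓘(ℝ, E) x₀ x₀)]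
        (fun y ↦ ĜF[G, x₀] y a b) :=
      hĜJ.mono fun y hy ↦ hy a b
    have h := congrArg (fun T : E →L[ℝ] ℝ ↦ T u) ((hDab (J a) (J b)).trans
      (hev.fderiv_eq.trans (hDab a b).symm))
    simpa only [ContinuousLinearMap.flip_apply] using h
  have hKjet : ∀ u v w, D u (J v) w - D v (J u) w + D w (J u) v = 0 := fun u v w ↦
    chartMetric_kaehler_jet G hG hH hK x₀ hD u v w
  -- the Koszul map
  obtain ⟨B, hB⟩ := exists_koszul (G x₀) S hS D
  have hBsymm : ∀ u v, B u v = B v u := fun u v ↦ koszul_symm' hpos hDsymm hB u v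
  have hBg : ∀ u v w, D u v w = G x₀ (B u v) w + G x₀ v (B u w) := fun u v w ↦
    koszul_metric' hsymm hDsymm hB u v w
  have hBJ : ∀ u v, B u (J v) = J (B u v) := fun u v ↦
    koszul_J' hpos J hJJ hJskew hDsymm hDJ hKjet hB u v
  -- the osculating unitary frame
  have hiso := eventually_frameM_isometry (G x₀) S B ĜF[G, x₀] (extChartAt 𝓘(ℝ, E) x₀ x₀) hpos hsymm hS hĜc hĜcont hĜsymm
  have hMd := hasFDerivAt_frameM (G x₀) S B ĜF[G, x₀] (extChartAt 𝓘(ℝ, E) x₀ x₀) hpos hsymm hS hĜc hĜs hĜsymm hD hBg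
  have hMs := eventually_contDiffAt_frameM (G x₀) S B ĜF[G, x₀] (extChartAt 𝓘(ℝ, E) x₀ x₀) hpos hS hĜc hĜs
  have hunit := eventually_isUnit_frameM (G x₀) S B ĜF[G, x₀] (extChartAt 𝓘(ℝ, E) x₀ x₀) hpos hS hĜc hĜcont
  have hcomm := eventually_frameM_comm (G x₀) S B ĜF[G, x₀] (extChartAt 𝓘(ℝ, E) x₀ x₀) hpos hS hĜc hĜcont J hJJ hJskew hĜJ hBJ
  have hM1 := frameM_apply_c (G x₀) S B ĜF[G, x₀] (extChartAt 𝓘(ℝ, E) x₀ x₀) hpos hS hĜc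
  -- transport to `M`
  have hT := continuousAt_extChartAt (I := 𝓘(ℝ, E)) x₀
  have hiso' := hT.eventually hiso
  have hcomm' := hT.eventually hcomm
  have hunit' := hT.eventually hunit
  have hMs' := hT.eventually hMs
  have hor' := eventually_orientation_testFrame G S B x₀ o hG ho hiso hMs.self_of_nhds hM1
  -- a bump function supported where the frame is invertible and smooth
  obtain ⟨f, -, hf⟩ := (SmoothBumpFunction.nhds_basis_tsupport (I := 𝓘(ℝ, E)) x₀).mem_iff.1
    (hunit'.and hMs')
  have hfu : ∀ z ∈ tsupport f, _ := fun z hz ↦ (hf hz).1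
  have hfs : ∀ z ∈ tsupport f, _ := fun z hz ↦ (hf hz).2
  have hf1 : ∀ᶠ y' in 𝓝 x₀, f y' = 1 := f.eventuallyEq_one
  -- expansion of `α` in test forms
  obtain ⟨N, ε, ρ, hρ, hexp⟩ := exists_expansion_testForms G S B x₀ α hα f hfu hfs
  rw [kaehlerP_congr_of_eventuallyEq o G h₁ h₃ hexp]
  refine kaehlerP_sum_fun_smul_eq_zero o G hG' ho h₁ h₃ Finset.univ _ (fun i _ ↦ ?_) ρ
    (fun i _ ↦ hρ i) x₀ (fun i _ ↦ ?_) (fun i _ ↦ ?_)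
  · exact isSmoothForm_testForm G S B x₀ f (ε i) hfs
  · exact kaehlerP_fun_smul o hHJ G hG ho h₁ h₃
      ((hρ i).contMDiffAt.mdifferentiableAt (by simp))
      (isSmoothForm_testForm G S B x₀ f (ε i) hfs)
  · exact kaehlerP_testForm_apply_eq_zero G S B x₀ o h₁ h₃ f hf1 (ε i) hBsymm hMd hiso' hcomm' hor'

set_option maxHeartbeats 1600000 in
/-- **The Kähler identity `[∂̄*, L] = i∂` on functions**: `∂̄*(Lα) - i∂α = 0` for every smooth
`0`-form `α` (the term `L(∂̄*α)` is absent). Same proof. [cite: Voisin2002, §6.1.1 Prop. 6.5] -/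
theorem kaehlerP_apply_eq_zero_zero (ho : IsSmoothForm (riemannianVolumeForm o))
    (G : M → E →L[ℝ] E →L[ℝ] ℝ) (hG : ∀ (x : M) (v w : TangentSpace 𝓘(ℝ, E) x), G x v w = ⟪v, w⟫)
    (hH : ∀ x v w, G x (Complex.I • v) (Complex.I • w) = G x v w)
    (hK : IsClosedForm (RiemannianBundle.g (E := fun x : M ↦ TangentSpace 𝓘(ℝ, E) x)).kaehlerForm)
    {m₁ : ℕ} (h₁ : (0 + 1 + 1) + m₁ = n)
    (α : MForm 𝓘(ℝ, E) M ℂ 0) (hα : IsSmoothForm α) (x₀ : M) :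
    (KP₀[G, o, h₁] α) x₀ = 0 := by
  haveI : CompleteSpace E := FiniteDimensional.complete ℂ E
  -- the complex structure on the model space
  set J : E →L[ℝ] E := (Complex.I • ContinuousLinearMap.id ℂ E).restrictScalars ℝ with hJdef
  have hJa : ∀ v, J v = Complex.I • v := fun v ↦ rfl
  have hJJ : ∀ v, J (J v) = -v := fun v ↦ by
    rw [hJa, hJa, smul_smul, Complex.I_mul_I, neg_one_smul]
  -- the metric at `x₀`
  have hpos : ∀ a, a ≠ 0 → 0 < G x₀ a a := chartMetric_pos G hG x₀
  have hGs : ∀ x a b, G x a b = G x b a := fun x a b ↦ by rw [hG, hG, real_inner_comm]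
  have hsymm : ∀ a b, G x₀ a b = G x₀ b a := hGs x₀
  have hJskew : ∀ a b, G x₀ (J a) b = -G x₀ a (J b) := fun a b ↦ by
    have h := hH x₀ a (Complex.I • b)
    rw [smul_smul, Complex.I_mul_I, neg_one_smul, map_neg] at h
    rw [hJa, hJa]
    linarith
  have hHJ : ∀ (x : M) (v w : TangentSpace 𝓘(ℝ, E) x), ⟪tangentJ E x v, tangentJ E x w⟫ = ⟪v, w⟫ :=
    fun x v w ↦ by rw [← hG, ← hG, tangentJ_apply, tangentJ_apply, hH]
  have hG' : ∀ (x : M) (v w : TangentSpace 𝓘(ℝ, E) x), G x v w = inner ℝ v w := hG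
  obtain ⟨S, hS, -⟩ := exists_riesz (G x₀) hpos
  -- the coordinate metric in the chart at `x₀` and its jet
  have hĜc := chartMetric_apply_c G x₀
  have hĜsymm : ∀ y a b, ĜF[G, x₀] y a b =
      ĜF[G, x₀] y b a :=
    fun y a b ↦ chartMetric_symm G hGs x₀ y a b
  have hĜs := eventually_contDiffAt_chartMetric G hG x₀
  have hĜcont := hĜs.self_of_nhds.continuousAt
  have hĜJ : ∀ᶠ y in 𝓝 (extChartAt 𝓘(ℝ, E) x₀ x₀), ∀ a b, ĜF[G, x₀] y (J a) (J b) =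
      ĜF[G, x₀] y a b := by
    filter_upwards [(isOpen_extChartAt_target (I := 𝓘(ℝ, E)) x₀).mem_nhds
      (mem_extChartAt_target x₀)] with y hy a b
    exact chartMetric_hermitian G hH x₀ hy a b
  have hD := (hĜs.self_of_nhds.differentiableAt (by simp)).hasFDerivAt
  set D := fderiv ℝ ĜF[G, x₀] (extChartAt 𝓘(ℝ, E) x₀ x₀) with hDdef
  have hDab : ∀ a b, (D.flip a).flip b = fderiv ℝ (fun y ↦ ĜF[G, x₀] y a b) (extChartAt 𝓘(ℝ, E) x₀ x₀) :=
    fun a b ↦ (hasFDerivAt_apply_apply hD a b).fderiv.symm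
  have hDsymm : ∀ u a b, D u a b = D u b a := fun u a b ↦ by
    have h := congrArg (fun T : E →L[ℝ] ℝ ↦ T u) ((hDab a b).trans
      ((congrArg (fun F : E → ℝ ↦ fderiv ℝ F (extChartAt 𝓘(ℝ, E) x₀ x₀))
        (funext fun y ↦ hĜsymm y a b)).trans (hDab b a).symm))
    simpa only [ContinuousLinearMap.flip_apply] using h
  have hDJ : ∀ u a b, D u (J a) (J b) = D u a b := fun u a b ↦ by
    have hev : (fun y ↦ ĜF[G, x₀] y (J a) (J b)) =ᶠ[𝓝 (extChartAt 𝓘(ℝ, E) x₀ x₀)]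
        (fun y ↦ ĜF[G, x₀] y a b) :=
      hĜJ.mono fun y hy ↦ hy a b
    have h := congrArg (fun T : E →L[ℝ] ℝ ↦ T u) ((hDab (J a) (J b)).trans
      (hev.fderiv_eq.trans (hDab a b).symm))
    simpa only [ContinuousLinearMap.flip_apply] using h
  have hKjet : ∀ u v w, D u (J v) w - D v (J u) w + D w (J u) v = 0 := fun u v w ↦
    chartMetric_kaehler_jet G hG hH hK x₀ hD u v w
  -- the Koszul map
  obtain ⟨B, hB⟩ := exists_koszul (G x₀) S hS D
  have hBsymm : ∀ u v, B u v = B v u := fun u v ↦ koszul_symm' hpos hDsymm hB u v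
  have hBg : ∀ u v w, D u v w = G x₀ (B u v) w + G x₀ v (B u w) := fun u v w ↦
    koszul_metric' hsymm hDsymm hB u v w
  have hBJ : ∀ u v, B u (J v) = J (B u v) := fun u v ↦
    koszul_J' hpos J hJJ hJskew hDsymm hDJ hKjet hB u v
  -- the osculating unitary frame
  have hiso := eventually_frameM_isometry (G x₀) S B ĜF[G, x₀] (extChartAt 𝓘(ℝ, E) x₀ x₀) hpos hsymm hS hĜc hĜcont hĜsymm
  have hMd := hasFDerivAt_frameM (G x₀) S B ĜF[G, x₀] (extChartAt 𝓘(ℝ, E) x₀ x₀) hpos hsymm hS hĜc hĜs hĜsymm hD hBg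
  have hMs := eventually_contDiffAt_frameM (G x₀) S B ĜF[G, x₀] (extChartAt 𝓘(ℝ, E) x₀ x₀) hpos hS hĜc hĜs
  have hunit := eventually_isUnit_frameM (G x₀) S B ĜF[G, x₀] (extChartAt 𝓘(ℝ, E) x₀ x₀) hpos hS hĜc hĜcont
  have hcomm := eventually_frameM_comm (G x₀) S B ĜF[G, x₀] (extChartAt 𝓘(ℝ, E) x₀ x₀) hpos hS hĜc hĜcont J hJJ hJskew hĜJ hBJ
  have hM1 := frameM_apply_c (G x₀) S B ĜF[G, x₀] (extChartAt 𝓘(ℝ, E) x₀ x₀) hpos hS hĜc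
  -- transport to `M`
  have hT := continuousAt_extChartAt (I := 𝓘(ℝ, E)) x₀
  have hiso' := hT.eventually hiso
  have hcomm' := hT.eventually hcomm
  have hunit' := hT.eventually hunit
  have hMs' := hT.eventually hMs
  have hor' := eventually_orientation_testFrame G S B x₀ o hG ho hiso hMs.self_of_nhds hM1
  -- a bump function supported where the frame is invertible and smooth
  obtain ⟨f, -, hf⟩ := (SmoothBumpFunction.nhds_basis_tsupport (I := 𝓘(ℝ, E)) x₀).mem_iff.1
    (hunit'.and hMs')
  have hfu : ∀ z ∈ tsupport f, _ := fun z hz ↦ (hf hz).1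
  have hfs : ∀ z ∈ tsupport f, _ := fun z hz ↦ (hf hz).2
  have hf1 : ∀ᶠ y' in 𝓝 x₀, f y' = 1 := f.eventuallyEq_one
  -- expansion of `α` in test forms
  obtain ⟨N, ε, ρ, hρ, hexp⟩ := exists_expansion_testForms G S B x₀ α hα f hfu hfs
  rw [kaehlerP_congr_of_eventuallyEq_zero o G h₁ hexp]
  refine kaehlerP_sum_fun_smul_eq_zero_zero o G hG' ho h₁ Finset.univ _ (fun i _ ↦ ?_) ρ
    (fun i _ ↦ hρ i) x₀ (fun i _ ↦ ?_) (fun i _ ↦ ?_)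
  · exact isSmoothForm_testForm G S B x₀ f (ε i) hfs
  · exact kaehlerP_fun_smul_zero o hHJ G hG ho h₁
      ((hρ i).contMDiffAt.mdifferentiableAt (by simp))
      (isSmoothForm_testForm G S B x₀ f (ε i) hfs)
  · exact kaehlerP_testForm_apply_eq_zero_zero G S B x₀ o h₁ f hf1 (ε i) hBsymm hMd hiso' hcomm'
      hor'


end Assembly

end Literature.NumberTheory.Transcendental
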